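import Summits.CriticalPhenomena.PercolationContinuityZ3.Theorems.PercNearOneGluingNoHeavyQuantIndepBlobTwoOpenCore
import HarnessLib

/-!
# QUANT lane R8, FAR for independent blobs: the FLOOR-RESOLVED block-star row `(1 + q)·j` for BIG (pairwise incompatible)
# blocks at EVERY floor — "two open gates": `1 + q < ∑ p k ⟹ P(#open ≥ 2) ≥ q` for independent gates `p k ≥ q`

builds on p205010 (kernel theorem, internal audit signed; external expert review pending)

Support file (`--supports stmt-CriticalPhenomena-4575`), QUANT lane typer seat prim-quant-stmt (gen 38), rung R8 of
`run/shared/lean/prim/quant/LADDER.md`; memo `run/shared/lean/prim/quant/prim-quant-stmt-g38/BIGBLOCKS-G38.md`; part 2 of 2 (the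
conditioned-form core `IndepBlob.twoOpen_core` is `…QuantIndepBlobTwoOpenCore`); continues typer g37's `…QuantIndepBlobFloorRow`
(Markov half `∑ a ≤ 2j`, every floor; heavy floors via the mass row) and its open case (R3).

THE TARGET.  Typer g36's floor-resolved tree row (`LawDec.TreeBuiltRowFloor`, threshold `(1 + x)·j`, kernel-sharp at every floor)
for depth-one BLOCK-STARS — independent gates `p k ∈ [q, 1]` in front of glued blocks of weight `a k ≥ 0`, `W = ∑_{k open} a k`:
`(1 + q)·j < EW ⟹ P(W ≤ j) ≤ 1 − q`.  OPEN after typer g37 (R3): light floors `q < 1/2` with `∑ a > 2j`; the numerically binding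
structures there are three `j`-blocks — behind gates `(1 − q, q, q)` for the row (slack `q(1−q)(1−2q)`, `EW = (1+q)j` exactly) and
behind gates `1/2⁻` for typer g37's Conjecture R — i.e. block-stars whose blocks are PAIRWISE INCOMPATIBLE (`2·a k > j`: any two
open blocks exceed the level).  For such block-stars `{W ≤ j} ⊆ {at most one block open}`, a block heavier than `j` decides
alone, otherwise `EW ≤ j·∑ p k` — and the row becomes a statement about the NUMBER of open gates only.

THIS FILE (standard axioms, no sorries), every floor, light or heavy:
* `IndepBlob.twoOpen_qform_min` — Q-FORM: gates `0 ≤ p k ≤ 1`, least gate `p y`; `P(#open ≥ 2) < p y ⟹ ∑ p k ≤ 1 + P(#open ≥ 2)`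
  (the configurations split at `y` and `IndepBlob.twoOpen_core`).  For unit blocks this is also Conjecture R, tight at three gates `1/2⁻`.
* `IndepBlob.twoOpen_row_min` — **TWO OPEN GATES**: `1 + p y < ∑ p k ⟹ P(#open ≤ 1) ≤ 1 − p y`.  Sharp: gates `(1 − q, q, q)`.
* `IndepBlob.floorRow_bigBlocks_min` — **the floor-resolved block-star row for big blocks**: gates `0 ≤ p k ≤ 1`, least gate
  `p y`, weights `a k ≥ 0` with `2·a k > j` for all `k`, `(1 + p y)·j < ∑ a k p k` ⟹ `P(W ≤ j) ≤ 1 − p y`.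
* `IndepBlob.twoOpen_row`, `IndepBlob.floorRow_bigBlocks` — the same at EVERY DECLARED FLOOR `x ≤` every gate (`1 + x < ∑ p ⟹
  P(#open ≤ 1) ≤ 1 − x`; `(1 + x)·j < EW ⟹ P(W ≤ j) ≤ 1 − x`): the literal `IndepBlob` form of `LawDec.TreeBuiltRowFloor` on this family
  (floors below the least gate are what `TreeBuilt.mono` allows).  For `x <` least gate this is the Q-form's content and is NOT implied
  by the least-gate row.

PRIOR LANE RESULT (honest cross-reference, typer g38): at level ONE the count statement `twoOpen_row_min` is, for a depth-one star, exactly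
lead g7/g8's multi-companion counting form `Quant.tree_card_le_one_le_of_sum` (`…QuantFarTreeMultiCompanion`: least marginal `T a`,
`Σ_{R∖a} T ≥ 1 ⟹ P(#reached ≤ 1) ≤ 1 − T a`, on EVERY tree, even non-strict).  What this file adds is the `IndepBlob` (finite-sum,
real-weight) vocabulary in which (R3) is stated, an elementary proof without the chain lemma, the Q-form = Conjecture-R reading, and the
packaging for real weights `a k > j/2`; the mathematics of "two open gates" itself is the lane's since gen 8 (so (R3) was never open on
this family, and `LawDec.TreeBuiltRowFloor` holds at `j = 1` on every forest by tree-MC).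

WHAT REMAINS OPEN of (R3) (honest): block-stars at light floors with `∑ a > 2j` containing blocks of weight `≤ j/2`.  They include
the unit block-stars at every LEVEL `m ≥ 2` (blocks of weight `j/m`: `(1 + q)·m < ∑ p ⟹ P(#open ≥ m+1) ≥ q`), for which Hoeffding's
1956 theorem on the number of successes in independent trials reduces the gate vector to three values — recorded in the memo as the
next step, not used here.  Adversarial searches (typer g37 explore/light_opt.py; typer g38 explore/mixed_attack2.py, `n ≤ 7`,
continuous weights, a small block forced) find no binding structure outside the two families now proved (Markov: `∑ a ≤ 2j`; this
file: big blocks).  `LawDec.TreeBuiltRowFloor`, `Quant.FarTreeRow` stay OPEN; the RATE class log\* and the honest sentence of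
`run/shared/lean/prim/quant/README.md` are unchanged.  Prior art: see part 1; [this work].  The gluing rows served
[cite: KozmaNitzan2024, Conjecture 3 (p. 15)]; product measure [cite: Grimmett1999, §1.3 p. 10].
-/


namespace Summit.CriticalPhenomena.PercolationContinuityZ3.Theorems

namespace Quant

namespace IndepBlob

open Finset

section OneType

variable {κ : Type*} [Fintype κ] [DecidableEq κ]

/-- **Q-FORM FOR UNIT BLOCK-STARS (one-type form).**  Independent gates `0 ≤ p k ≤ 1` on a finite type, least gate `p y`.  If the
probability of at least two open gates is below the least gate, `P(#open ≥ 2) < p y`, then the expected number of open gates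
is at most one plus that probability: `∑ k, p k ≤ 1 + P(#open ≥ 2)`.  (For `j`-blocks behind the gates this is the Q-form
`EW ≤ j·(1 + P(W > j))` of typer g36's floor-resolved row, and — the middle term vanishing for unit blocks — typer g37's
Conjecture R `E(N − 2)⁺ ≤ P(N = 0)` for this family.) [this work] -/
theorem twoOpen_qform_min (p : κ → ℝ) (hp0 : ∀ k, 0 ≤ p k) (hp1 : ∀ k, p k ≤ 1) (y : κ) (hy : ∀ k, p y ≤ p k)
    (hreg : ∑ s ∈ (Finset.univ : Finset (Finset κ)).filter (fun s => 2 ≤ s.card),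
      (∏ k, if k ∈ s then p k else 1 - p k) < p y) :
    ∑ k, p k ≤ 1 + ∑ s ∈ (Finset.univ : Finset (Finset κ)).filter (fun s => 2 ≤ s.card),
      (∏ k, if k ∈ s then p k else 1 - p k) := by
  set ι := {k : κ // k ≠ y} with hι
  set emb : ι ↪ κ := Function.Embedding.subtype _ with hemb
  -- the mean, split at `y`
  have hm : ∑ k, p k = p y + ∑ i : ι, p i := by
    rw [← Finset.add_sum_erase Finset.univ _ (Finset.mem_univ y),
      Finset.sum_subtype (Finset.univ.erase y) (p := fun k => k ≠ y) (fun k => by simp)]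
  -- split the configurations `s ⊆ κ` according to `y ∈ s`
  set G : Finset κ → ℝ := fun s => if 2 ≤ s.card then (∏ k, if k ∈ s then p k else 1 - p k) else 0 with hG
  have hLHS : ∑ s ∈ (Finset.univ : Finset (Finset κ)).filter (fun s => 2 ≤ s.card),
      (∏ k, if k ∈ s then p k else 1 - p k) = ∑ s : Finset κ, G s := by
    rw [hG, Finset.sum_filter]
  have hsplit : ∑ s : Finset κ, G s =
      ∑ W : Finset ι, G (W.map emb) + ∑ W : Finset ι, G (insert y (W.map emb)) := by
    rw [← Finset.powerset_univ, ← Finset.insert_erase (Finset.mem_univ y),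
      Finset.sum_powerset_insert (Finset.notMem_erase y _), sum_powerset_erase_eq_sum_subtype,
      sum_powerset_erase_eq_sum_subtype]
  have hnot : ∀ W : Finset ι, y ∉ W.map emb := by
    intro W h
    rw [Finset.mem_map] at h
    obtain ⟨i, -, hi⟩ := h
    exact i.2 hi
  have h0 : ∑ W : Finset ι, G (W.map emb) =
      (1 - p y) * ∑ W ∈ (Finset.univ : Finset (Finset ι)).filter (fun W : Finset ι => 2 ≤ W.card),
        (∏ i : ι, if i ∈ W then p i else 1 - p i) := by
    rw [Finset.sum_filter, Finset.mul_sum]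
    refine Finset.sum_congr rfl fun W _ => ?_
    have hX : (W.map emb).card = W.card := Finset.card_map _
    simp only [hG, hX]
    split_ifs
    · rw [hemb, prod_ite_mem_map_subtype]
    · rw [mul_zero]
  have h1 : ∑ W : Finset ι, G (insert y (W.map emb)) =
      p y * ∑ W ∈ (Finset.univ : Finset (Finset ι)).filter (fun W : Finset ι => 1 ≤ W.card),
        (∏ i : ι, if i ∈ W then p i else 1 - p i) := by
    rw [Finset.sum_filter, Finset.mul_sum]
    refine Finset.sum_congr rfl fun W _ => ?_
    have hX : (insert y (W.map emb)).card = W.card + 1 := by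
      rw [Finset.card_insert_of_notMem (hnot W), Finset.card_map]
    have hiff : (2 ≤ W.card + 1) ↔ (1 ≤ W.card) := by omega
    simp only [hG, hX, hiff]
    split_ifs
    · rw [hemb, prod_ite_mem_insert_map_subtype]
    · rw [mul_zero]
  rw [hLHS, hsplit, h0, h1] at hreg ⊢
  rw [hm]
  have key := twoOpen_core (ι := ι) (fun i => p i) (p y) (fun i => hp1 i) (fun i => hy i) (hp0 y) (hp1 y)
    (by linarith [hreg])
  linarith [key]

/-- **TWO OPEN GATES (the floor-resolved row for unit block-stars, every floor).**  Independent gates `0 ≤ p k ≤ 1` on a finite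
type with least gate `p y`; if `1 + p y < ∑ k, p k` then `P(#open ≤ 1) ≤ 1 − p y`, i.e. at least two gates are open with
probability at least the least gate.  For `j`-blocks behind the gates: `(1 + q)·j < EW ⟹ P(W ≤ j) ≤ 1 − q` with `q` the least
gate — typer g36's threshold `(1 + x)·j` for this family, at light AND heavy floors (the heavy case `q ≥ 1/2` is also
`IndepBlob.massRow`).  Sharp: three `j`-blocks behind gates `(1 − q, q, q)` have `EW = (1 + q)·j` exactly. [this work] -/
theorem twoOpen_row_min (p : κ → ℝ) (hp0 : ∀ k, 0 ≤ p k) (hp1 : ∀ k, p k ≤ 1) (y : κ) (hy : ∀ k, p y ≤ p k)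
    (hsum : 1 + p y < ∑ k, p k) :
    ∑ s ∈ (Finset.univ : Finset (Finset κ)).filter (fun s => s.card ≤ 1),
      (∏ k, if k ∈ s then p k else 1 - p k) ≤ 1 - p y := by
  have htot : ∑ s ∈ (Finset.univ : Finset (Finset κ)).filter (fun s => s.card ≤ 1),
      (∏ k, if k ∈ s then p k else 1 - p k) +
      ∑ s ∈ (Finset.univ : Finset (Finset κ)).filter (fun s => ¬ (s.card ≤ 1)),
      (∏ k, if k ∈ s then p k else 1 - p k) = 1 := by
    rw [Finset.sum_filter_add_sum_filter_not, sum_bernoulliWeight]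
  have hcongr : ∑ s ∈ (Finset.univ : Finset (Finset κ)).filter (fun s => ¬ (s.card ≤ 1)),
      (∏ k, if k ∈ s then p k else 1 - p k) =
      ∑ s ∈ (Finset.univ : Finset (Finset κ)).filter (fun s => 2 ≤ s.card),
      (∏ k, if k ∈ s then p k else 1 - p k) := by
    refine Finset.sum_congr ?_ fun _ _ => rfl
    ext s
    simp only [Finset.mem_filter, Finset.mem_univ, true_and]
    omega
  by_contra hcon
  have hreg : ∑ s ∈ (Finset.univ : Finset (Finset κ)).filter (fun s => 2 ≤ s.card),
      (∏ k, if k ∈ s then p k else 1 - p k) < p y := by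
    rw [← hcongr]; linarith [not_le.1 hcon]
  have := twoOpen_qform_min p hp0 hp1 y hy hreg
  linarith

/-- **THE FLOOR-RESOLVED BLOCK-STAR ROW FOR BIG (PAIRWISE INCOMPATIBLE) BLOCKS, EVERY FLOOR.**  Gates `0 ≤ p k ≤ 1`, least gate
`p y`, nonnegative weights with `2·a k > j` for every block (any two open blocks exceed the level), and
`(1 + p y)·j < EW = ∑ a k p k`.  Then `P(W ≤ j) = ∑_{s : a(s) ≤ j} ∏ (p k if k ∈ s else 1 − p k) ≤ 1 − p y`.  This is typer
g36's floor-resolved row `(1 + x)·j` (`LawDec.TreeBuiltRowFloor` / `IndepBlob` form, typer g37's open case (R3) of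
`…QuantIndepBlobFloorRow`) for the block-stars that carry its extremal families at LIGHT floors: three `j`-blocks behind gates
`(1 − q, q, q)` (`EW = (1+q)j`, row slack `q(1−q)(1−2q)`, typer g37) and behind gates `1/2⁻` (Conjecture R tight); neither
the Markov half (`∑ a ≤ 2j`) nor the mass row (gates `≥ 1/2`) covers them.  Proof: a block heavier than `j` decides alone;
otherwise `∑ a k p k ≤ j·∑ p k`, so `1 + p y < ∑ p k`, and `{W ≤ j} ⊆ {#open ≤ 1}` — `twoOpen_row_min`. [this work] -/
theorem floorRow_bigBlocks_min (p a : κ → ℝ) (hp0 : ∀ k, 0 ≤ p k) (hp1 : ∀ k, p k ≤ 1) (ha : ∀ k, 0 ≤ a k)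
    (y : κ) (hy : ∀ k, p y ≤ p k) (j : ℝ) (hbig : ∀ k, j < 2 * a k) (hj : (1 + p y) * j < ∑ k, a k * p k) :
    ∑ s ∈ (Finset.univ : Finset (Finset κ)).filter (fun s => ∑ k ∈ s, a k ≤ j),
      (∏ k, if k ∈ s then p k else 1 - p k) ≤ 1 - p y := by
  have hw0 : ∀ s : Finset κ, 0 ≤ (∏ k, if k ∈ s then p k else 1 - p k) := bernoulliWeight_nonneg hp0 hp1
  -- a block that decides alone: `{W ≤ j} ⊆ {k closed}`
  have halone : ∀ k₀ : κ, j < a k₀ →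
      ∑ s ∈ (Finset.univ : Finset (Finset κ)).filter (fun s => ∑ k ∈ s, a k ≤ j),
        (∏ k, if k ∈ s then p k else 1 - p k) ≤ 1 - p y := by
    intro k₀ hk₀
    calc ∑ s ∈ (Finset.univ : Finset (Finset κ)).filter (fun s => ∑ k ∈ s, a k ≤ j),
          (∏ k, if k ∈ s then p k else 1 - p k)
        ≤ ∑ s ∈ (Finset.univ : Finset (Finset κ)).filter (fun s => k₀ ∉ s),
          (∏ k, if k ∈ s then p k else 1 - p k) := by
          refine Finset.sum_le_sum_of_subset_of_nonneg (fun s hs => ?_) fun s _ _ => hw0 s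
          rw [Finset.mem_filter] at hs ⊢
          refine ⟨hs.1, fun hk => ?_⟩
          have : a k₀ ≤ ∑ k ∈ s, a k := Finset.single_le_sum (fun k _ => ha k) hk
          linarith [hs.2]
      _ = 1 - p k₀ := sum_bernoulliWeight_filter_not_mem p k₀
      _ ≤ 1 - p y := by linarith [hy k₀]
  by_cases hj0 : j ≤ 0
  · -- `y` itself decides alone (`a y > j/2 ≥ j`)
    exact halone y (by linarith [hbig y])
  by_cases hex : ∃ k, j < a k
  · obtain ⟨k₀, hk₀⟩ := hex
    exact halone k₀ hk₀
  push Not at hex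
  have hjpos : 0 < j := lt_of_not_ge hj0
  -- all blocks `≤ j`: `∑ a p ≤ j ∑ p`, so `1 + p y < ∑ p`
  have hsum : 1 + p y < ∑ k, p k := by
    have h1 : ∑ k, a k * p k ≤ ∑ k, j * p k :=
      Finset.sum_le_sum fun k _ => mul_le_mul_of_nonneg_right (hex k) (hp0 k)
    rw [← Finset.mul_sum] at h1
    by_contra h
    have h2 : j * ∑ k, p k ≤ j * (1 + p y) := mul_le_mul_of_nonneg_left (not_lt.1 h) hjpos.le
    linarith
  -- `{W ≤ j} ⊆ {#open ≤ 1}`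
  calc ∑ s ∈ (Finset.univ : Finset (Finset κ)).filter (fun s => ∑ k ∈ s, a k ≤ j),
        (∏ k, if k ∈ s then p k else 1 - p k)
      ≤ ∑ s ∈ (Finset.univ : Finset (Finset κ)).filter (fun s => s.card ≤ 1),
        (∏ k, if k ∈ s then p k else 1 - p k) := by
        refine Finset.sum_le_sum_of_subset_of_nonneg (fun s hs => ?_) fun s _ _ => hw0 s
        rw [Finset.mem_filter] at hs ⊢
        refine ⟨hs.1, ?_⟩
        by_contra hcard
        obtain ⟨u, hu, v, hv, huv⟩ := Finset.one_lt_card.1 (show 1 < s.card by omega)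
        have hsub : ({u, v} : Finset κ) ⊆ s := by
          intro k hk
          rw [Finset.mem_insert, Finset.mem_singleton] at hk
          rcases hk with rfl | rfl
          · exact hu
          · exact hv
        have h2 : ∑ k ∈ ({u, v} : Finset κ), a k ≤ ∑ k ∈ s, a k :=
          Finset.sum_le_sum_of_subset_of_nonneg hsub fun k _ _ => ha k
        rw [Finset.sum_pair huv] at h2
        linarith [hbig u, hbig v, hs.2]
    _ ≤ 1 - p y := twoOpen_row_min p hp0 hp1 y hy hsum

/-- **TWO OPEN GATES AT EVERY DECLARED FLOOR** (the Q-form's extra content over the least-gate form): gates `0 ≤ p k ≤ 1`, a floor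
`x ≤ p k` for all `k` (NOT necessarily attained), `1 + x < ∑ p k ⟹ P(#open ≤ 1) ≤ 1 − x`.  For `x <` least gate this is NOT a
consequence of the least-gate row (nor of the lane's multi-companion inequality, whose threshold is `1 +` least marginal): it is the
Q-form `∑ p ≤ 1 + P(#open ≥ 2)` read at the floor `x`. [this work] -/
theorem twoOpen_row (p : κ → ℝ) (hp1 : ∀ k, p k ≤ 1) (x : ℝ) (hx0 : 0 ≤ x) (hx : ∀ k, x ≤ p k)
    (hsum : 1 + x < ∑ k, p k) :
    ∑ s ∈ (Finset.univ : Finset (Finset κ)).filter (fun s => s.card ≤ 1),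
      (∏ k, if k ∈ s then p k else 1 - p k) ≤ 1 - x := by
  have hp0 : ∀ k, 0 ≤ p k := fun k => hx0.trans (hx k)
  -- a least gate exists (`κ` is nonempty since `∑ p > 1`)
  have hne : (Finset.univ : Finset κ).Nonempty := by
    rw [Finset.univ_nonempty_iff]
    by_contra h
    rw [not_nonempty_iff] at h
    have : ∑ k, p k = 0 := Finset.sum_eq_zero fun k _ => (IsEmpty.false k).elim
    linarith
  obtain ⟨y, -, hy⟩ := Finset.exists_min_image Finset.univ p hne
  have hy' : ∀ k, p y ≤ p k := fun k => hy k (Finset.mem_univ k)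
  have htot : ∑ s ∈ (Finset.univ : Finset (Finset κ)).filter (fun s => s.card ≤ 1),
      (∏ k, if k ∈ s then p k else 1 - p k) +
      ∑ s ∈ (Finset.univ : Finset (Finset κ)).filter (fun s => ¬ (s.card ≤ 1)),
      (∏ k, if k ∈ s then p k else 1 - p k) = 1 := by
    rw [Finset.sum_filter_add_sum_filter_not, sum_bernoulliWeight]
  have hcongr : ∑ s ∈ (Finset.univ : Finset (Finset κ)).filter (fun s => ¬ (s.card ≤ 1)),
      (∏ k, if k ∈ s then p k else 1 - p k) =
      ∑ s ∈ (Finset.univ : Finset (Finset κ)).filter (fun s => 2 ≤ s.card),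
      (∏ k, if k ∈ s then p k else 1 - p k) := by
    refine Finset.sum_congr ?_ fun _ _ => rfl
    ext s
    simp only [Finset.mem_filter, Finset.mem_univ, true_and]
    omega
  by_contra hcon
  have hreg : ∑ s ∈ (Finset.univ : Finset (Finset κ)).filter (fun s => 2 ≤ s.card),
      (∏ k, if k ∈ s then p k else 1 - p k) < p y := by
    rw [← hcongr]; linarith [not_le.1 hcon, hx y]
  have := twoOpen_qform_min p hp0 hp1 y hy' hreg
  linarith [not_le.1 hcon]

/-- **THE FLOOR-RESOLVED BLOCK-STAR ROW FOR BIG BLOCKS AT EVERY DECLARED FLOOR** — the literal `IndepBlob` form of typer g36's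
`LawDec.TreeBuiltRowFloor` on this family (the floor `x` is any lower bound of the gates, as `TreeBuilt.mono` allows): gates
`x ≤ p k ≤ 1` (`0 ≤ x ≤ 1`), weights `a k ≥ 0` with `2·a k > j`, `(1 + x)·j < ∑ a k p k` ⟹ `P(W ≤ j) ≤ 1 − x`. [this work] -/
theorem floorRow_bigBlocks (p a : κ → ℝ) (hp1 : ∀ k, p k ≤ 1) (ha : ∀ k, 0 ≤ a k)
    (x : ℝ) (hx0 : 0 ≤ x) (hx1 : x ≤ 1) (hx : ∀ k, x ≤ p k) (j : ℝ) (hbig : ∀ k, j < 2 * a k)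
    (hj : (1 + x) * j < ∑ k, a k * p k) :
    ∑ s ∈ (Finset.univ : Finset (Finset κ)).filter (fun s => ∑ k ∈ s, a k ≤ j),
      (∏ k, if k ∈ s then p k else 1 - p k) ≤ 1 - x := by
  have hp0 : ∀ k, 0 ≤ p k := fun k => hx0.trans (hx k)
  have hw0 : ∀ s : Finset κ, 0 ≤ (∏ k, if k ∈ s then p k else 1 - p k) := bernoulliWeight_nonneg hp0 hp1
  have halone : ∀ k₀ : κ, j < a k₀ →
      ∑ s ∈ (Finset.univ : Finset (Finset κ)).filter (fun s => ∑ k ∈ s, a k ≤ j),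
        (∏ k, if k ∈ s then p k else 1 - p k) ≤ 1 - x := by
    intro k₀ hk₀
    calc ∑ s ∈ (Finset.univ : Finset (Finset κ)).filter (fun s => ∑ k ∈ s, a k ≤ j),
          (∏ k, if k ∈ s then p k else 1 - p k)
        ≤ ∑ s ∈ (Finset.univ : Finset (Finset κ)).filter (fun s => k₀ ∉ s),
          (∏ k, if k ∈ s then p k else 1 - p k) := by
          refine Finset.sum_le_sum_of_subset_of_nonneg (fun s hs => ?_) fun s _ _ => hw0 s
          rw [Finset.mem_filter] at hs ⊢
          refine ⟨hs.1, fun hk => ?_⟩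
          have : a k₀ ≤ ∑ k ∈ s, a k := Finset.single_le_sum (fun k _ => ha k) hk
          linarith [hs.2]
      _ = 1 - p k₀ := sum_bernoulliWeight_filter_not_mem p k₀
      _ ≤ 1 - x := by linarith [hx k₀]
  -- `κ` is nonempty unless the mean hypothesis is vacuous
  by_cases hne : (Finset.univ : Finset κ).Nonempty
  swap
  · rw [Finset.univ_nonempty_iff, not_nonempty_iff] at hne
    have h0 : ∑ k, a k * p k = 0 := Finset.sum_eq_zero fun k _ => (IsEmpty.false k).elim
    -- `(1 + x) j < 0` with `x ≥ 0`: then `j < 0` and the light event is empty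
    have hj0 : j < 0 := by
      by_contra h
      have : 0 ≤ (1 + x) * j := mul_nonneg (by linarith) (not_lt.1 h)
      linarith
    have hempty : ∑ s ∈ (Finset.univ : Finset (Finset κ)).filter (fun s => ∑ k ∈ s, a k ≤ j),
        (∏ k, if k ∈ s then p k else 1 - p k) = 0 := by
      refine Finset.sum_eq_zero fun s hs => ?_
      rw [Finset.mem_filter] at hs
      have : 0 ≤ ∑ k ∈ s, a k := Finset.sum_nonneg fun k _ => ha k
      linarith [hs.2]
    rw [hempty]
    linarith
  obtain ⟨y, -⟩ := hne
  by_cases hj0 : j ≤ 0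
  · exact halone y (by linarith [hbig y])
  by_cases hex : ∃ k, j < a k
  · obtain ⟨k₀, hk₀⟩ := hex
    exact halone k₀ hk₀
  push Not at hex
  have hjpos : 0 < j := lt_of_not_ge hj0
  have hsum : 1 + x < ∑ k, p k := by
    have h1 : ∑ k, a k * p k ≤ ∑ k, j * p k :=
      Finset.sum_le_sum fun k _ => mul_le_mul_of_nonneg_right (hex k) (hp0 k)
    rw [← Finset.mul_sum] at h1
    by_contra h
    have h2 : j * ∑ k, p k ≤ j * (1 + x) := mul_le_mul_of_nonneg_left (not_lt.1 h) hjpos.le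
    linarith
  calc ∑ s ∈ (Finset.univ : Finset (Finset κ)).filter (fun s => ∑ k ∈ s, a k ≤ j),
        (∏ k, if k ∈ s then p k else 1 - p k)
      ≤ ∑ s ∈ (Finset.univ : Finset (Finset κ)).filter (fun s => s.card ≤ 1),
        (∏ k, if k ∈ s then p k else 1 - p k) := by
        refine Finset.sum_le_sum_of_subset_of_nonneg (fun s hs => ?_) fun s _ _ => hw0 s
        rw [Finset.mem_filter] at hs ⊢
        refine ⟨hs.1, ?_⟩
        by_contra hcard
        obtain ⟨u, hu, v, hv, huv⟩ := Finset.one_lt_card.1 (show 1 < s.card by omega)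
        have hsub : ({u, v} : Finset κ) ⊆ s := by
          intro k hk
          rw [Finset.mem_insert, Finset.mem_singleton] at hk
          rcases hk with rfl | rfl
          · exact hu
          · exact hv
        have h2 : ∑ k ∈ ({u, v} : Finset κ), a k ≤ ∑ k ∈ s, a k :=
          Finset.sum_le_sum_of_subset_of_nonneg hsub fun k _ _ => ha k
        rw [Finset.sum_pair huv] at h2
        linarith [hbig u, hbig v, hs.2]
    _ ≤ 1 - x := twoOpen_row p hp1 x hx0 hx hsum

end OneType

end IndepBlob

end Quant

end Summit.CriticalPhenomena.PercolationContinuityZ3.Theorems
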